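import Mathlib
import HarnessLib
import Summits.NavierStokesRegularity.NavierStokesRegularity.Theses.TypeIIInviscidRelaxation
import Literature.Analysis.FluidPDE.TypeIICoreWitness

set_option linter.dupNamespace false

/-!
# Line `axisymmetric_comparison_flow` for crux `MonopoleCoreExclusion` (stmt-NavierStokesRegularity-1965)

LINE-FIRST SKELETON (linewriter-ns-typeiiinviscid-1, g1 — second variant; g0 registered
`anchored_late_axisymmetric_core`: anchor [L] + monolithic local horizon given `AX` [XL]).  The crux (rank 4 of route
`TypeIIInviscidRelaxation`): GIVEN `AxisymSwirlRegular` (`AX`, global regularity of axisymmetric Navier–Stokes with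
swirl — a HYPOTHESIS here), a non-Type-I blow-up whose velocity-maximum core is, at every level `K` and frequently
before `T`, `K⁻¹`-close on `K` core radii to an AXISYMMETRIC profile is impossible.

ARCHITECTURE (comparison flow, three research stubs, kernel-checked composition).  g0's horizon stub ("given `AX`, a
late axisymmetric witness ⇒ `u` bounded on `[t,T) × B(x₀, KL/2)`") mixes the TRANSFER from `AX` with the STABILITY
problem.  This line separates them — and the transfer half becomes an honest M-item, because the azimuthal average of
`u(t)` about the witness axis is automatically smooth, divergence-free, finite-energy and exactly axisymmetric:

* `stub_anchoredLateAxisymWitness` [research · L] — SHARED with g0 (same name, same signature): a point `xs` singular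
  at `T`, covered at every level `K` by a LATE (`(T-t)V ≤ KL`) axisymmetric witness ANCHORED at `xs`
  (`dist xs x₀ ≤ KL/4`).
* `stub_axisymComparisonFlowOfAX` [research · M; the TRANSFER] — given `AX`: from a level-`K ≥ 1` axisymmetric
  witness at time `t` build an EXACTLY axisymmetric (about the witness axis `x₀ + ℝ·Q e_z`) classical Navier–Stokes
  solution `v` on `[t, T]`, bounded, with `‖u(t) - v(t)‖ ≤ A·V/K` on the core ball `B(x₀, KL)` (`A` universal).
  Mechanism: `v(t) :=` azimuthal average of `u(t)` about the witness axis (it is `2V/K`-close to `u(t)` on the core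
  ball because `u(t)` is `V/K`-close there to the axisymmetric `V·QW(Q⁻¹(·-x₀)/L)` and rotations about the axis preserve
  the ball; averaging over the rotation group commutes with `div` and preserves smoothness, energy and rapid decay);
  `AX` + time shift + rigid motion give the global smooth continuation.  Why it might fail: bookkeeping only
  (propagation of rapid spatial decay from the datum to time `t`; pointwise boundedness of the `AX`-solution on the
  compact horizon) — no size of `∇v` is claimed.
* `stub_axisymShadowing` [research · XL → the honest residue] — STABILITY of the blow-up solution `u` around the
  axisymmetric flow `v` on the finite horizon `[t,T)`, `(T-t)V ≤ KL`, locally on `B(x₀, KL/2)`, from `C⁰`-closeness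
  `A·V/K` on `B(x₀, KL)` at time `t` and core Reynolds number `≥ K`, for `K ≥ K₀(A)`.  Print anchors for the
  mechanism: Ponce–Racke–Sideris–Titi 1994 (stability of large global solutions), Gallay–Šverák 2019 /
  Bedrossian–Germain–Harrop-Griffiths 2018 (stability of viscous vortex rings / filaments) — all perturbative RELATIVE
  TO `ν`; here the perturbation is `V/K` in `C⁰` at Reynolds `≥ K` (Gronwall over `K` turnovers costs `e^{CK·Re}`),
  exterior fluid reaches `B(x₀, KL/2)` within the horizon, pressure is non-local.  This is where the crux is open.
* `MonopoleCoreExclusion_of` — PROVED composition (as g0: `ρ = min (K₀L/4) √(T-t)`).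

No new definitions; stubs over `TypeIICoreWitness`, `IsAxisymmetric`, `eZ`, `IsClassicalNSSolutionOn`,
`IsMaximalSmoothSolution`, `IsLerayHopfOn`, `HasRapidSpatialDecay`, `IsTypeIBlowup` and the route decl
`AxisymSwirlRegular`.  Navier–Stokes regularity is NOT proved by anything here.  decomp-ns line-writer g1.
-/

namespace Summit.NavierStokesRegularity.NavierStokesRegularity.Cruxes.MonopoleCoreExclusion.AxisymmetricComparisonFlow

open Literature.Analysis.FluidPDE Set Metric

/-- [research · L; SHARED with line `anchored_late_axisymmetric_core`] **Anchored late axisymmetric witnesses.**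
Under the solution hypotheses of the crux `MonopoleCoreExclusion` (maximal smooth Leray–Hopf solution from rapidly
decaying data, not Type I, axisymmetric core witnesses at every level frequently before `T`), there is a point `xs`,
SINGULAR at time `T` (unbounded on every backward parabolic neighbourhood), such that for every level `K > 0` some
level-`K` axisymmetric witness `(t, x₀, L, V, Q, W)`, `0 < t < T`, is LATE — `(T - t)·V ≤ K·L` — and ANCHORED at
`xs` — `dist xs x₀ ≤ K·L/4`. -/
theorem stub_anchoredLateAxisymWitness {ν T : ℝ}
    {u : ℝ → EuclideanSpace ℝ (Fin 3) → EuclideanSpace ℝ (Fin 3)}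
    {p : ℝ → EuclideanSpace ℝ (Fin 3) → ℝ}
    (hν : 0 < ν) (hT : 0 < T) (hmax : IsMaximalSmoothSolution ν 0 u p T)
    (hLH : IsLerayHopfOn T ν 0 (u 0) u) (hdec : HasRapidSpatialDecay (u 0))
    (hnI : ¬ IsTypeIBlowup u T)
    (hw : ∀ K : ℝ, 0 < K → ∀ t₀ < T, ∃ t, t₀ < t ∧ t < T ∧ TypeIICoreWitness IsAxisymmetric ν K u t) :
    ∃ xs : EuclideanSpace ℝ (Fin 3),
      (¬ ∃ ρ M : ℝ, 0 < ρ ∧ ∀ s ∈ Ioo (T - ρ ^ 2) T, ∀ x ∈ ball xs ρ, ‖u s x‖ ≤ M) ∧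
      ∀ K : ℝ, 0 < K → ∃ t : ℝ, 0 < t ∧ t < T ∧
        ∃ (x₀ : EuclideanSpace ℝ (Fin 3)) (L V : ℝ)
          (Q : EuclideanSpace ℝ (Fin 3) ≃ₗᵢ[ℝ] EuclideanSpace ℝ (Fin 3))
          (W : EuclideanSpace ℝ (Fin 3) → EuclideanSpace ℝ (Fin 3)),
          0 < L ∧ 0 < V ∧ IsAxisymmetric W ∧ (∀ x, ‖u t x‖ ≤ V) ∧
          (∃ x₁, dist x₁ x₀ ≤ L ∧ V ≤ 2 * ‖u t x₁‖) ∧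
          (∃ y y' : EuclideanSpace ℝ (Fin 3), ‖y‖ ≤ 1 ∧ ‖y'‖ ≤ 1 ∧ (4 : ℝ)⁻¹ ≤ ‖W y - W y'‖) ∧
          K * ν ≤ L * V ∧
          (∀ y : EuclideanSpace ℝ (Fin 3), ‖y‖ ≤ K →
            ‖V⁻¹ • Q.symm (u t (x₀ + L • Q y)) - W y‖ ≤ K⁻¹) ∧
          (T - t) * V ≤ K * L ∧ dist xs x₀ ≤ K * L / 4 := by
  sorry

/-- [research · M; the TRANSFER from `AxisymSwirlRegular`] **Axisymmetric comparison flow.**  If axisymmetric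
Navier–Stokes with swirl is globally regular (`AX`), there is a universal `A > 0` such that: whenever a classical
solution `u` on `[0,T)` (Leray–Hopf, rapidly decaying datum) carries at a time `0 < t < T` a level-`K ≥ 1` axisymmetric
core datum — sup `‖u(t)‖ ≤ V`, core Reynolds number `LV/ν ≥ K`, and `V⁻¹Q⁻¹u(t)(x₀ + LQ·)` is `K⁻¹`-close on
`‖y‖ ≤ K` to an axisymmetric profile `W` — there is an EXACTLY AXISYMMETRIC (about the witness axis: the pulled-back
field `y ↦ Q⁻¹ v(s, x₀ + Q y)` is `IsAxisymmetric`) classical Navier–Stokes solution `v` (pressure `q`) on `[t, T]`,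
bounded on `[t,T] × ℝ³`, with `‖u(t,x) - v(t,x)‖ ≤ A·V/K` on the core ball `B(x₀, KL)`.  (`v(t)` = azimuthal average
of `u(t)` about the witness axis — smooth, divergence-free, finite energy, rapidly decaying, `2V/K`-close on the core
ball; `AX`, a time shift and a rigid motion continue it globally.) -/
theorem stub_axisymComparisonFlowOfAX
    (hAX : Summit.NavierStokesRegularity.NavierStokesRegularity.Theses.TypeIIInviscidRelaxation.AxisymSwirlRegular) :
    ∃ A : ℝ, 0 < A ∧
      ∀ (ν T t K : ℝ) (u : ℝ → EuclideanSpace ℝ (Fin 3) → EuclideanSpace ℝ (Fin 3))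
        (p : ℝ → EuclideanSpace ℝ (Fin 3) → ℝ),
        0 < ν → 0 < T → IsClassicalNSSolutionOn (Ico 0 T) ν 0 u p → IsLerayHopfOn T ν 0 (u 0) u →
        HasRapidSpatialDecay (u 0) → 0 < t → t < T → 1 ≤ K →
        ∀ (x₀ : EuclideanSpace ℝ (Fin 3)) (L V : ℝ)
          (Q : EuclideanSpace ℝ (Fin 3) ≃ₗᵢ[ℝ] EuclideanSpace ℝ (Fin 3))
          (W : EuclideanSpace ℝ (Fin 3) → EuclideanSpace ℝ (Fin 3)),
          0 < L → 0 < V → IsAxisymmetric W → (∀ x, ‖u t x‖ ≤ V) → K * ν ≤ L * V →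
          (∀ y : EuclideanSpace ℝ (Fin 3), ‖y‖ ≤ K →
            ‖V⁻¹ • Q.symm (u t (x₀ + L • Q y)) - W y‖ ≤ K⁻¹) →
          ∃ (v : ℝ → EuclideanSpace ℝ (Fin 3) → EuclideanSpace ℝ (Fin 3))
            (q : ℝ → EuclideanSpace ℝ (Fin 3) → ℝ) (Mv : ℝ),
            IsClassicalNSSolutionOn (Icc t T) ν 0 v q ∧
            (∀ s ∈ Icc t T, IsAxisymmetric (fun y : EuclideanSpace ℝ (Fin 3) => Q.symm (v s (x₀ + Q y)))) ∧
            (∀ s ∈ Icc t T, ∀ x, ‖v s x‖ ≤ Mv) ∧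
            (∀ x ∈ ball x₀ (K * L), ‖u t x - v t x‖ ≤ A * V / K) := by
  sorry

/-- [research · XL — the honest residue of the crux; print anchors Ponce–Racke–Sideris–Titi 1994 (stability of large
global solutions), Gallay–Šverák 2019, Bedrossian–Germain–Harrop-Griffiths 2018 (viscous vortex rings / filaments)]
**Finite-horizon local shadowing of an axisymmetric flow by the blow-up solution.**  For every `A > 0` there is a
level `K₀ ≥ 1` such that for `K ≥ K₀`: if a classical solution `u` on `[0,T)` (Leray–Hopf, rapidly decaying datum)
has at time `0 < t < T` the core normalisation (sup `‖u(t)‖ ≤ V`, a near-maximum within `L` of `x₀`, core Reynolds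
number `LV/ν ≥ K`), the horizon is at most `K` core turnovers (`(T-t)V ≤ KL`), and an exactly axisymmetric (about the
axis `x₀ + ℝ·Q e_z`) bounded classical solution `v` on `[t,T]` is `A·V/K`-close to `u(t)` on `B(x₀, KL)`, then `u`
is bounded on `[t,T) × B(x₀, KL/2)`.  Why it might fail: `C⁰`-closeness `V/K` at Reynolds `≥ K` is far from the
`ν`-relative smallness every printed stability theorem needs (Gronwall over `K` turnovers costs `e^{CK·Re}`); exterior
fluid reaches the inner ball within the horizon; pressure is non-local. -/
theorem stub_axisymShadowing :
    ∀ A : ℝ, 0 < A → ∃ K₀ : ℝ, 1 ≤ K₀ ∧ ∀ K : ℝ, K₀ ≤ K →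
      ∀ (ν T t : ℝ) (u : ℝ → EuclideanSpace ℝ (Fin 3) → EuclideanSpace ℝ (Fin 3))
        (p : ℝ → EuclideanSpace ℝ (Fin 3) → ℝ),
        0 < ν → 0 < T → IsClassicalNSSolutionOn (Ico 0 T) ν 0 u p → IsLerayHopfOn T ν 0 (u 0) u →
        HasRapidSpatialDecay (u 0) → 0 < t → t < T →
        ∀ (x₀ : EuclideanSpace ℝ (Fin 3)) (L V : ℝ)
          (Q : EuclideanSpace ℝ (Fin 3) ≃ₗᵢ[ℝ] EuclideanSpace ℝ (Fin 3)),
          0 < L → 0 < V → (∀ x, ‖u t x‖ ≤ V) →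
          (∃ x₁, dist x₁ x₀ ≤ L ∧ V ≤ 2 * ‖u t x₁‖) → K * ν ≤ L * V → (T - t) * V ≤ K * L →
          ∀ (v : ℝ → EuclideanSpace ℝ (Fin 3) → EuclideanSpace ℝ (Fin 3))
            (q : ℝ → EuclideanSpace ℝ (Fin 3) → ℝ) (Mv : ℝ),
            IsClassicalNSSolutionOn (Icc t T) ν 0 v q →
            (∀ s ∈ Icc t T, IsAxisymmetric (fun y : EuclideanSpace ℝ (Fin 3) => Q.symm (v s (x₀ + Q y)))) →
            (∀ s ∈ Icc t T, ∀ x, ‖v s x‖ ≤ Mv) →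
            (∀ x ∈ ball x₀ (K * L), ‖u t x - v t x‖ ≤ A * V / K) →
            ∃ M : ℝ, ∀ s ∈ Ico t T, ∀ x ∈ ball x₀ (K * L / 2), ‖u s x‖ ≤ M := by
  sorry

/-- **Composition (kernel-checked, no sorry outside the stubs):** the three stubs imply the crux
`MonopoleCoreExclusion` BY NAME.  `AX` feeds the transfer stub, which gives the universal `A`; `K₀(A)` from the
shadowing stub; a late level-`K₀` axisymmetric witness anchored at the singular point `xs`; the comparison flow `v`;
the bound on `[t, T) × B(x₀, K₀L/2)` ⊇ `(T - ρ², T) × B_ρ(xs)`, `ρ = min (K₀L/4) √(T - t)` — contradiction. -/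
theorem MonopoleCoreExclusion_of :
    Summit.NavierStokesRegularity.NavierStokesRegularity.Theses.TypeIIInviscidRelaxation.MonopoleCoreExclusion := by
  intro hAX ν T hν hT u p hmax hLH hdec hnI hw
  obtain ⟨A, hA, hcomp⟩ := stub_axisymComparisonFlowOfAX hAX
  obtain ⟨K₀, hK₀1, hstab⟩ := stub_axisymShadowing A hA
  have hK₀ : 0 < K₀ := lt_of_lt_of_le one_pos hK₀1
  obtain ⟨xs, hsing, hcov⟩ := stub_anchoredLateAxisymWitness hν hT hmax hLH hdec hnI hw
  obtain ⟨t, ht0, htT, x₀, L, V, Q, W, hL, hV, hax, hbd, hnear, hosc, hRe, hclose, hlate, hdist⟩ :=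
    hcov K₀ hK₀
  obtain ⟨v, q, Mv, hv, hvax, hvbd, hvclose⟩ :=
    hcomp ν T t K₀ u p hν hT hmax.1 hLH hdec ht0 htT hK₀1 x₀ L V Q W hL hV hax hbd hRe hclose
  obtain ⟨M, hM⟩ := hstab K₀ le_rfl ν T t u p hν hT hmax.1 hLH hdec ht0 htT x₀ L V Q hL hV hbd hnear
    hRe hlate v q Mv hv hvax hvbd hvclose
  apply hsing
  have hTt : 0 < T - t := sub_pos.2 htT
  set ρ : ℝ := min (K₀ * L / 4) (Real.sqrt (T - t)) with hρ
  have hρpos : 0 < ρ := lt_min (by positivity) (Real.sqrt_pos.2 hTt)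
  have hρsq : ρ ^ 2 ≤ T - t :=
    calc ρ ^ 2 ≤ (Real.sqrt (T - t)) ^ 2 := pow_le_pow_left₀ hρpos.le (min_le_right _ _) 2
      _ = T - t := Real.sq_sqrt hTt.le
  have hρle : ρ ≤ K₀ * L / 4 := min_le_left _ _
  refine ⟨ρ, M, hρpos, fun s hs x hx => hM s ⟨?_, hs.2⟩ x ?_⟩
  · linarith [hs.1]
  · rw [mem_ball] at hx ⊢
    calc dist x x₀ ≤ dist x xs + dist xs x₀ := dist_triangle _ _ _
      _ < ρ + K₀ * L / 4 := by linarith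
      _ ≤ K₀ * L / 4 + K₀ * L / 4 := by linarith
      _ = K₀ * L / 2 := by ring

end Summit.NavierStokesRegularity.NavierStokesRegularity.Cruxes.MonopoleCoreExclusion.AxisymmetricComparisonFlow
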